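import Mathlib
import HarnessLib
import HarnessLib.Audit
import Summits.Langlands.Statement
import Summits.Langlands.Langlands.Theses.QuarterConductorLadder
import Summits.Langlands.Langlands.Theses.SeedParityLadder
import Summits.Langlands.Langlands.Theses.SenNullAlignment
import Literature.NumberTheory.Automorphic.HilbertPartialHasseWeightShifting
import Literature.NumberTheory.Automorphic.StrongApproximationGL2
import Literature.NumberTheory.Automorphic.GLnAdelicStructureProofs

/-!
# BC3 birth skeleton — crux `HolomorphicSeedAvatars` (HOL) of the lens-1-g19 child route `SeedParityLadder`
# (cutting QO = `Summit.Langlands.Langlands.Theses.QuarterConductorLadder.OffQuarterBoxAvatars` stmt-Langlands-26826 by the archimedean sign vector of the totally-real non-regular Hilbert seed)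

Line «print existence → seed transport» (memo §3, line card `birth_HOL.md`).  AFTER-BIRTH version: the crux is the TREE decl `Summit.Langlands.Langlands.Theses.SeedParityLadder.HolomorphicSeedAvatars` (stmt-Langlands-27035, route born rev 0 @88f139fd10ac,
refines QuarterConductorLadder:OffQuarterBoxAvatars); `HolomorphicSeedAvatars_proof` concludes it BY NAME from the stubs; register as `Lines/birth.lean` of item 27035.

Stubs (genuine lemmas of the line; sorries ONLY here):
  stub₁ `stub_oddNonRegularAttached` : the TREE ITEM `Summit.Langlands.Langlands.Theses.SenNullAlignment.OddNonRegularAttached` (stmt-Langlands-16362, support, open, route-Langlands-SenNullAlignment) BY NAME —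
         existence of an irreducible ℓ-adic avatar, Satake–Frobenius compatible at almost all places, for every L-algebraic cuspidal π on GL₂ over a totally real field of
         infinity type weight (k, w) with some k_β = 1 and holomorphic sign vector.  PRINT: Rogawski–Tunnell 1983 (parallel weight one), Jarvis 1997 Thm 6.1 + end of §3
         (partial weight one; irreducibility by Ribet's argument), Newton 2015 Thm 1 / Rem 2 [corpus:paper:arxiv-1409.6535 p.3]; K = ℚ: Deligne–Serre 1974 Thm 4.1.  It is the
         named Literature fact `Literature.NumberTheory.Automorphic.exists_galoisRep_GL2_totallyReal_partialWeightOne` instantiated (that module is not built on the farm today,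
         so the item is cited through the tree route decl; its infinity type is inlined there and is `hilbertInfinityType k w` by `rfl` — the composition below is that check).
         L-sized as a typing job (the Satake normalisation must be matched), shared staffing with route-Langlands-SenNullAlignment.
  stub₂ `stub_seedTransport` : SEED TRANSPORT — avatars pass along the a.e. relation P_w ↔ (α_u^f, χ_w) from a totally real K₀ to K ⊇ K₀: ρ := r|_(Γ_K) ⊗ (ℓ-adic character
         of the L-algebraic GL₁ datum χ — Weil/Serre type-A₀ realisation, tree `AlgebraicHeckeCharacterData` pattern); Frobenius at w ↦ Frob_u^(f_w) gives the charpoly of α^f;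
         semisimplicity is preserved by restriction to the open subgroup Γ_K (Clifford) and by twisting.  M-sized; PRINT (class field theory + linear algebra).
Composition `holomorphicSeedAvatars_of` destructures the box hypothesis (`subst n = 2`), gets r from stub₁ over the seed field K₀ and feeds stub₂; it concludes the crux
BY NAME.  Probes S0–S6: no stub alone gives the crux or Langlands on the cheap, no stub is cheap outright, the crux does not give stub₁ back on the cheap.
rc 0 with sorries = 2 (stub_* only) is the certificate.
-/

set_option linter.dupNamespace false
set_option linter.unreachableTactic false
set_option linter.unusedTactic false
set_option linter.unusedVariables false
set_option maxHeartbeats 400000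

namespace Summit.Langlands.Langlands.Cruxes.HolomorphicSeedAvatars.Birth

open scoped BigOperators Topology Manifold Classical MeasureTheory ProbabilityTheory Matrix InnerProductSpace ComplexConjugate ContinuousMap
open Filter Set Function TopologicalSpace MeasureTheory
open Literature.NumberTheory.Automorphic Literature.NumberTheory.GaloisRepresentations

/-- AFTER BIRTH (route-Langlands-SeedParityLadder rev 0 @88f139fd10ac, HOL = stmt-Langlands-27035): the crux is the TREE decl, referenced by name. -/
abbrev HolomorphicSeedAvatars : Prop :=
  Summit.Langlands.Langlands.Theses.SeedParityLadder.HolomorphicSeedAvatars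

/-- stub₂ text · SEED TRANSPORT along the a.e.-twisted base-change relation from a totally real K₀ to K. -/
def SeedTransport : Prop :=
  ∀ (K₀ : Type) [Field K₀] [NumberField K₀] (K : Type) [Field K] [NumberField K] [Algebra K₀ K] (hcpt : Literature.NumberTheory.Automorphic.isCompact_glFiniteIntegralLevel 2 K) (P : Literature.NumberTheory.Automorphic.AutomorphicRepData (Literature.NumberTheory.Automorphic.AutomorphyDatum.gl 2 K hcpt)) (ℓ : ℕ) [Fact ℓ.Prime] (ι : PadicAlgCl ℓ ≃+* ℂ) (h₀ : Literature.NumberTheory.Automorphic.isCompact_glFiniteIntegralLevel 2 K₀) (π₀ : Literature.NumberTheory.Automorphic.CuspidalAutomorphicRepData 2 K₀ h₀) (h₁ : Literature.NumberTheory.Automorphic.isCompact_glFiniteIntegralLevel 1 K) (χ : Literature.NumberTheory.Automorphic.AutomorphicRepData (Literature.NumberTheory.Automorphic.AutomorphyDatum.gl 1 K h₁)) (r : Literature.NumberTheory.GaloisRepresentations.FramedGaloisRep K₀ (PadicAlgCl ℓ) 2), r.toGaloisRep.IsSemisimple → (∀ᶠ u : IsDedekindDomain.HeightOneSpectrum (NumberField.RingOfIntegers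 K₀) in Filter.cofinite, Summit.Langlands.SatakeFrobCompatibleAt ι π₀.1 r u) → χ.IsLAlgebraic → (∀ᶠ w : IsDedekindDomain.HeightOneSpectrum (NumberField.RingOfIntegers K) in Filter.cofinite, ∀ (u : IsDedekindDomain.HeightOneSpectrum (NumberField.RingOfIntegers K₀)) (α : Multiset ℂ) (c : ℂ), w.asIdeal.under (NumberField.RingOfIntegers K₀) = u.asIdeal → π₀.1.HasSatakeParamAt u α → χ.HasSatakeParamAt w {c} → P.HasSatakeParamAt w ((α.map (· ^ w.asIdeal.inertiaDeg (NumberField.RingOfIntegers K₀))).map (c * ·))) → ∃ ρ : Literature.NumberTheory.GaloisRepresentations.FramedGaloisRep K (PadicAlgCl ℓ) 2, ρ.toGaloisRep.IsSemisimple ∧ ∀ᶠ v : IsDedekindDomain.HeightOneSpectrum (NumberField.RingOfIntegers K) in Filter.cofinite, Summit.Langlands.SatakeFrobCompatibleAt ι P ρ v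

/-- stub₁ — the print existence = tree item stmt-Langlands-16362 BY NAME (Rogawski–Tunnell, Jarvis 1997 Thm 6.1, Newton 2015 Thm 1; Deligne–Serre). -/
theorem stub_oddNonRegularAttached : Summit.Langlands.Langlands.Theses.SenNullAlignment.OddNonRegularAttached := by
  sorry

/-- stub₂ — restriction to Γ_K ⊗ χ_ℓ (PRINT: CFT + Clifford).  RESHAPE (lead hand-3, 2026-08-31): the registered signature is
now the TEXT of `SeedTransport` (self-contained, so that a `Theorems/` file can prove it verbatim by name; `SeedTransport` above is
kept as the line card's abbreviation and is definitionally this statement). -/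
theorem stub_seedTransport : ∀ (K₀ : Type) [Field K₀] [NumberField K₀] (K : Type) [Field K] [NumberField K] [Algebra K₀ K] (hcpt : Literature.NumberTheory.Automorphic.isCompact_glFiniteIntegralLevel 2 K) (P : Literature.NumberTheory.Automorphic.AutomorphicRepData (Literature.NumberTheory.Automorphic.AutomorphyDatum.gl 2 K hcpt)) (ℓ : ℕ) [Fact ℓ.Prime] (ι : PadicAlgCl ℓ ≃+* ℂ) (h₀ : Literature.NumberTheory.Automorphic.isCompact_glFiniteIntegralLevel 2 K₀) (π₀ : Literature.NumberTheory.Automorphic.CuspidalAutomorphicRepData 2 K₀ h₀) (h₁ : Literature.NumberTheory.Automorphic.isCompact_glFiniteIntegralLevel 1 K) (χ : Literature.NumberTheory.Automorphic.AutomorphicRepData (Literature.NumberTheory.Automorphic.AutomorphyDatum.gl 1 K h₁)) (r : Literature.NumberTheory.GaloisRepresentations.FramedGaloisRep K₀ (PadicAlgCl ℓ) 2), r.toGaloisRep.IsSemisimple → (∀ᶠ u : IsDedekindDomain.HeightOneSpectrum (NumberField.RingOfIntegers K₀) in Filter.cofinite, Summit.Langlands.SatakeFrobCompatibleAt ι π₀.1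 r u) → χ.IsLAlgebraic → (∀ᶠ w : IsDedekindDomain.HeightOneSpectrum (NumberField.RingOfIntegers K) in Filter.cofinite, ∀ (u : IsDedekindDomain.HeightOneSpectrum (NumberField.RingOfIntegers K₀)) (α : Multiset ℂ) (c : ℂ), w.asIdeal.under (NumberField.RingOfIntegers K₀) = u.asIdeal → π₀.1.HasSatakeParamAt u α → χ.HasSatakeParamAt w {c} → P.HasSatakeParamAt w ((α.map (· ^ w.asIdeal.inertiaDeg (NumberField.RingOfIntegers K₀))).map (c * ·))) → ∃ ρ : Literature.NumberTheory.GaloisRepresentations.FramedGaloisRep K (PadicAlgCl ℓ) 2, ρ.toGaloisRep.IsSemisimple ∧ ∀ᶠ v : IsDedekindDomain.HeightOneSpectrum (NumberField.RingOfIntegers K) in Filter.cofinite, Summit.Langlands.SatakeFrobCompatibleAt ι P ρ v := by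
  sorry

/-- An irreducible `ℚ̄_ℓ`-representation is semisimple. [folklore; node kernel] -/
theorem isSemisimple_of_isIrreducible {K : Type} [Field K] {ℓ : ℕ} [Fact ℓ.Prime] {n : ℕ}
    (ρ : FramedGaloisRep K (PadicAlgCl ℓ) n) (h : ρ.toGaloisRep.IsIrreducible) : ρ.toGaloisRep.IsSemisimple := by
  haveI := h
  change ComplementedLattice _
  infer_instance

/-- COMPOSITION — concludes the crux `HolomorphicSeedAvatars` BY NAME from the two stubs (real proof, no sorry).  The `exact hA …` line is the check that the dial's
`hilbertInfinityType k w` and sign clause are DEFINITIONALLY the hypotheses of the tree item. -/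
theorem holomorphicSeedAvatars_of (hA : Summit.Langlands.Langlands.Theses.SenNullAlignment.OddNonRegularAttached) (hTr : SeedTransport) : HolomorphicSeedAvatars := by
  intro K _ _ n hcpt hn π hL hbox hhol h2 h3 ℓ _ ι
  obtain ⟨hn2, K₀, _, _, _, hTR, h₀, π₀, k, w, h₁, χ, hL₀, hT, hsgn, hk1, hχ, hrel⟩ := hhol
  subst hn2
  obtain ⟨r, hirr, hc⟩ := hA K₀ hTR h₀ π₀ k w hL₀ hT hsgn hk1 ℓ ι
  exact hTr K₀ K hcpt π.1 ℓ ι h₀ π₀ h₁ χ r (isSemisimple_of_isIrreducible r hirr) hc hχ hrel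

theorem holomorphicSeedAvatars_holds_of_stubs : HolomorphicSeedAvatars :=
  holomorphicSeedAvatars_of stub_oddNonRegularAttached stub_seedTransport

/-- `ledger skeleton check` handle: the FQ tree crux BY NAME from the stubs (operator INBOX note 2026-08-29). -/
theorem HolomorphicSeedAvatars_proof : Summit.Langlands.Langlands.Theses.SeedParityLadder.HolomorphicSeedAvatars :=
  holomorphicSeedAvatars_of stub_oddNonRegularAttached stub_seedTransport

/-- NON-VACUITY of the dial's seed binder (critic row 227 y3 pattern): `h₀` is dischargeable over every number field, so the box is not empty for lack of a
level structure on GL₂/K₀.  (An in-box π itself = e.g. an odd A₅-type weight-one newform over ℚ, or Moy–Specter's non-CM partial weight one form over ℚ(√5)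
[corpus:paper:arxiv-1407.3872 p.2]; exhibiting one in Lean needs a constructed cusp form — the refuter's check (iii), not a stub.) -/
example (K₀ : Type) [Field K₀] [NumberField K₀] : Literature.NumberTheory.Automorphic.isCompact_glFiniteIntegralLevel 2 K₀ :=
  Literature.NumberTheory.Automorphic.isCompact_glFiniteIntegralLevel_holds 2 K₀

/-! ## Per-stub probes (fail_if_success: rc 0 ⇒ every cheap attempt FAILED) -/

-- S0: stub₁ alone ↛ crux
example : True := by
  fail_if_success
    have : Summit.Langlands.Langlands.Theses.SenNullAlignment.OddNonRegularAttached → HolomorphicSeedAvatars := by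
      first | exact fun h => h | (intros; assumption) | (intros; trivial) | tauto
  trivial

-- S1: stub₂ alone ↛ crux
example : True := by
  fail_if_success
    have : SeedTransport → HolomorphicSeedAvatars := by
      first | exact fun h => h | (intros; assumption) | (intros; trivial) | tauto
  trivial

-- S2: stub₁ ↛ Langlands
example : True := by
  fail_if_success
    have : Summit.Langlands.Langlands.Theses.SenNullAlignment.OddNonRegularAttached → _root_.Langlands := by
      first | exact fun h => h | (intros; assumption) | (intros; trivial) | tauto
  trivial

-- S3: stub₂ ↛ Langlands
example : True := by
  fail_if_success
    have : SeedTransport → _root_.Langlands := by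
      first | exact fun h => h | (intros; assumption) | (intros; trivial) | tauto
  trivial

-- S4: stub₁ not cheap outright
example : True := by
  fail_if_success
    have : Summit.Langlands.Langlands.Theses.SenNullAlignment.OddNonRegularAttached := by
      first | exact fun h => h | (intros; assumption) | (intros; trivial) | tauto
  trivial

-- S5: stub₂ not cheap outright
example : True := by
  fail_if_success
    have : SeedTransport := by
      first | exact fun h => h | (intros; assumption) | (intros; trivial) | tauto
  trivial

-- S6: crux ↛ stub₁ cheaply (the fact is not the crux reworded: it has no K, no χ, no hull hypotheses)
example : True := by
  fail_if_success
    have : HolomorphicSeedAvatars → Summit.Langlands.Langlands.Theses.SenNullAlignment.OddNonRegularAttached := by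
      first | exact fun h => h | (intros; assumption) | (intros; trivial) | tauto
  trivial

-- S7: crux ↛ QO (tree) cheaply — the cell is a proper restriction
example : True := by
  fail_if_success
    have : HolomorphicSeedAvatars → Summit.Langlands.Langlands.Theses.QuarterConductorLadder.OffQuarterBoxAvatars := by
      first | exact fun h => h | (intros; assumption) | (intros; trivial) | tauto
  trivial

end Summit.Langlands.Langlands.Cruxes.HolomorphicSeedAvatars.Birth
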